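/- Free-seat work of EXTRA WIDTH SEAT `ym-line-cbag-p1-w5` (prover-ym-line-cbag-p1-w5-g2-0), route `EguchiKawaiDirectionLadder`
(ideator ym-idea-2, LINE 8), crux `TripleSmallBallMargin` (stmt-QuantumFields-27724): the SPECTRAL WINDOW LAW of one Haar link — how
the eigenvalue configuration of `U 0` is paid for in the books of stubs (a)/(b) (sizing note of width seat w4 g2, evidence #7 on 27724:
«window law of U 0 ≤ e^{O(N²)} ⊗ Haar via Vandermonde factorisation — needs the Weyl integration formula for U(N) as a named
Literature fact»).  Everything here is CONDITIONAL on that named fact (`Literature.Probability.RandomMatrix.WeylIntegrationFormulaUN`,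
typed in `Literature/Probability/RandomMatrix/WeylIntegrationFormula.lean`, unproved in the tree) except the Vandermonde and
characteristic-polynomial bookkeeping, which is unconditional.  Route-independent (no Theses import).  Nothing here bears on the
Yang–Mills mass gap (LINE 8 is a barrier-ledger line onto `EguchiKawaiBreakdown`). -/
import Literature.Probability.RandomMatrix.WeylIntegrationFormula

/-!
# Spectral window law for a Haar unitary (conditional on Weyl's integration formula)

For a Haar-distributed `U ∈ U(N)` and an event `E ⊆ U(N)` that depends on `U` only through its spectrum (equivalently: is
closed under conjugation), Weyl's integration formula prices `E` by an eigenangle integral against the Vandermonde weight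
`∏_{j<k} |e^{iθ_j} − e^{iθ_k}|²`.  This file derives the forms used by small-ball bookkeeping:

* `vandermondeCircleWeight_le` — `∏_{j<k} |e^{iθ_j} − e^{iθ_k}|² ≤ 4^{N(N−1)/2}` (each factor `≤ 4`), and
  `vandermondeCircleWeight_le_mul_prod_filter` — the same keeping any selected sub-family of pair factors (the pairs inside an
  eigenvalue cluster are the ones to be charged; the rest cost `≤ 4` each);
* `haar_apply_eq_of_weyl` — `Haar(E) = (N!(2π)^N)⁻¹ ∫_{[−π,π]^N} ∏_{j<k}|e^{iθ_j} − e^{iθ_k}|² 𝟙_E(diag(e^{iθ})) dθ` for measurable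
  conjugation-invariant `E`;
* `haar_apply_le_of_weyl` — the `e^{O(N²)}`-FLAT WINDOW LAW
  `Haar(E) ≤ (N!(2π)^N)⁻¹ · 4^{N(N−1)/2} · Leb{θ ∈ [−π,π]^N : diag(e^{iθ}) ∈ E}`: the spectrum of a Haar unitary costs at most
  `e^{O(N²)}` more than `N` independent uniform eigenangles ("N! fine, N^{N²} not": `(N!(2π)^N)⁻¹ 4^{N(N−1)/2} ≤ e^{N² log 2}`);
* spectral events ARE conjugation invariant: `charpoly_unitary_conj` (the characteristic polynomial, hence the root multiset
  `spec`, is a class function on `U(N)`), `charpoly_roots_diagPhases` (the spectrum of `diag(e^{iθ})` is the multiset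
  `{e^{iθ_j}}`), and the packaged form `haar_spectralEvent_le_of_weyl` for events `{U | P (roots of charpoly U)}`.
-/

set_option autoImplicit false

noncomputable section

open MeasureTheory Polynomial
open scoped ENNReal Real

namespace Summit.QuantumFields.YangMills.Theorems.EguchiKawaiDirectionLadder.SpectralWindow

open Literature.Probability.RandomMatrix (WeylIntegrationFormulaUN)
open Literature.MathematicalPhysics.QuantumFieldTheory (haarProbability)
open Literature.LinearAlgebra.Matrix (diagonalTorusHom coe_diagonalTorusHom_apply continuous_diagonalTorusHom)

/-! Throughout, the eigenangle parametrisation is `θ ↦ diagonalTorusHom (Fin N) (fun j => Circle.exp (θ j))`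
(`= diag(e^{iθ_1}, …, e^{iθ_N}) ∈ U(N)`), the eigenangle box is `Set.pi Set.univ (fun _ => Set.Icc (-π) π)`
(`= [−π, π]^N`, the `eigenBox` of `GrossWittenTransition.lean`) and the Vandermonde weight is written out as
`∏ j, ∏ k ∈ Finset.Ioi j, ‖e^{iθ_j} − e^{iθ_k}‖²` (`= cueWeight N θ` there) — no auxiliary definitions. -/

/-- The eigenangle parametrisation `θ ↦ diag(e^{iθ})` is continuous. -/
theorem continuous_diagPhases (N : ℕ) :
    Continuous fun θ : Fin N → ℝ => diagonalTorusHom (Fin N) fun j => Circle.exp (θ j) := by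
  have h1 : Continuous fun θ : Fin N → ℝ => fun j => Circle.exp (θ j) :=
    continuous_pi fun j => Circle.exp.continuous.comp (continuous_apply j)
  exact (continuous_diagonalTorusHom (n := Fin N)).comp h1

/-- The matrix of the eigenangle parametrisation is `diag(e^{iθ_j})`. -/
theorem coe_diagPhases (N : ℕ) (θ : Fin N → ℝ) :
    ((diagonalTorusHom (Fin N) fun j => Circle.exp (θ j) : Matrix.unitaryGroup (Fin N) ℂ) :
        Matrix (Fin N) (Fin N) ℂ) =
      Matrix.diagonal fun j => Complex.exp (θ j * Complex.I) := by
  rw [coe_diagonalTorusHom_apply]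
  rfl

/-! ### The Vandermonde weight on the circle: crude bounds (proved) -/

/-- Each pair factor is at most `4`: `|e^{iθ} − e^{iφ}|² ≤ (1 + 1)² = 4`. [folklore] -/
theorem norm_cexp_sub_cexp_sq_le_four (a b : ℝ) :
    ‖Complex.exp (a * Complex.I) - Complex.exp (b * Complex.I)‖ ^ 2 ≤ 4 := by
  have h1 : ‖Complex.exp (a * Complex.I)‖ = 1 := Complex.norm_exp_ofReal_mul_I a
  have h2 : ‖Complex.exp (b * Complex.I)‖ = 1 := Complex.norm_exp_ofReal_mul_I b
  have h : ‖Complex.exp (a * Complex.I) - Complex.exp (b * Complex.I)‖ ≤ 2 := by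
    calc ‖Complex.exp (a * Complex.I) - Complex.exp (b * Complex.I)‖
        ≤ ‖Complex.exp (a * Complex.I)‖ + ‖Complex.exp (b * Complex.I)‖ := norm_sub_le _ _
      _ = 2 := by rw [h1, h2]; norm_num
  nlinarith [norm_nonneg (Complex.exp (a * Complex.I) - Complex.exp (b * Complex.I))]

/-- The number of pairs `j < k` in `Fin N` is `N(N−1)/2`. [folklore] -/
theorem sum_card_Ioi_fin (N : ℕ) : ∑ j : Fin N, (Finset.Ioi j).card = N * (N - 1) / 2 := by
  have h : ∀ j : Fin N, (Finset.Ioi j).card = N - 1 - (j : ℕ) := fun j => Fin.card_Ioi j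
  simp_rw [h]
  rw [Fin.sum_univ_eq_sum_range (fun i => N - 1 - i) N]
  have hrefl : ∑ i ∈ Finset.range N, (N - 1 - i) = ∑ i ∈ Finset.range N, i :=
    Finset.sum_range_reflect (fun i => i) N
  rw [hrefl, Finset.sum_range_id]

/-- **Crude Vandermonde bound**: `∏_{j<k} |e^{iθ_j} − e^{iθ_k}|² ≤ 4^{N(N−1)/2}` — the eigenvalue density of
a Haar unitary is at most `e^{O(N²)}` times flat. [folklore] -/
theorem vandermondeCircleWeight_le (N : ℕ) (θ : Fin N → ℝ) :
    ∏ j : Fin N, ∏ k ∈ Finset.Ioi j,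
        ‖Complex.exp (θ j * Complex.I) - Complex.exp (θ k * Complex.I)‖ ^ 2 ≤
      (4 : ℝ) ^ (N * (N - 1) / 2) := by
  rw [← sum_card_Ioi_fin N, ← Finset.prod_pow_eq_pow_sum]
  refine Finset.prod_le_prod (fun j _ => Finset.prod_nonneg fun k _ => by positivity) fun j _ => ?_
  calc ∏ k ∈ Finset.Ioi j, ‖Complex.exp (θ j * Complex.I) - Complex.exp (θ k * Complex.I)‖ ^ 2
      ≤ ∏ _k ∈ Finset.Ioi j, (4 : ℝ) :=
        Finset.prod_le_prod (fun k _ => by positivity) fun k _ => norm_cexp_sub_cexp_sq_le_four _ _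
    _ = 4 ^ (Finset.Ioi j).card := Finset.prod_const 4

/-- **Keeping a sub-family of pair factors**: for any selection `p` of pairs, the full Vandermonde weight is at
most `4^{N(N−1)/2}` times the product of the SELECTED pair factors (the unselected ones are `≤ 4`, the selected
ones are kept; useful when only the pairs inside an eigenvalue cluster are to be charged). [folklore] -/
theorem vandermondeCircleWeight_le_mul_prod_filter (N : ℕ) (θ : Fin N → ℝ) (p : Fin N → Fin N → Prop)
    [∀ j k, Decidable (p j k)] :
    ∏ j : Fin N, ∏ k ∈ Finset.Ioi j,
        ‖Complex.exp (θ j * Complex.I) - Complex.exp (θ k * Complex.I)‖ ^ 2 ≤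
      (4 : ℝ) ^ (N * (N - 1) / 2) *
        ∏ j : Fin N, ∏ k ∈ (Finset.Ioi j).filter (p j),
          ‖Complex.exp (θ j * Complex.I) - Complex.exp (θ k * Complex.I)‖ ^ 2 := by
  set w : Fin N → Fin N → ℝ := fun j k =>
    ‖Complex.exp (θ j * Complex.I) - Complex.exp (θ k * Complex.I)‖ ^ 2 with hw
  have hw0 : ∀ j k, 0 ≤ w j k := fun j k => by positivity
  have hw4 : ∀ j k, w j k ≤ 4 := fun j k => norm_cexp_sub_cexp_sq_le_four _ _
  -- split each inner product into selected and unselected pairs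
  have hsplit : ∀ j : Fin N, ∏ k ∈ Finset.Ioi j, w j k =
      (∏ k ∈ (Finset.Ioi j).filter (p j), w j k) *
        ∏ k ∈ (Finset.Ioi j).filter (fun k => ¬ p j k), w j k :=
    fun j => (Finset.prod_filter_mul_prod_filter_not (Finset.Ioi j) (p j) (w j)).symm
  have hrest : ∀ j : Fin N, ∏ k ∈ (Finset.Ioi j).filter (fun k => ¬ p j k), w j k ≤
      (4 : ℝ) ^ (Finset.Ioi j).card := by
    intro j
    calc ∏ k ∈ (Finset.Ioi j).filter (fun k => ¬ p j k), w j k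
        ≤ ∏ _k ∈ (Finset.Ioi j).filter (fun k => ¬ p j k), (4 : ℝ) :=
          Finset.prod_le_prod (fun k _ => hw0 j k) fun k _ => hw4 j k
      _ = 4 ^ ((Finset.Ioi j).filter (fun k => ¬ p j k)).card := Finset.prod_const 4
      _ ≤ 4 ^ (Finset.Ioi j).card :=
          pow_le_pow_right₀ (by norm_num) (Finset.card_filter_le _ _)
  calc ∏ j : Fin N, ∏ k ∈ Finset.Ioi j, w j k
      = ∏ j : Fin N, ((∏ k ∈ (Finset.Ioi j).filter (p j), w j k) *
          ∏ k ∈ (Finset.Ioi j).filter (fun k => ¬ p j k), w j k) := Finset.prod_congr rfl fun j _ => hsplit j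
    _ ≤ ∏ j : Fin N, ((∏ k ∈ (Finset.Ioi j).filter (p j), w j k) * (4 : ℝ) ^ (Finset.Ioi j).card) := by
        refine Finset.prod_le_prod (fun j _ => mul_nonneg (Finset.prod_nonneg fun k _ => hw0 j k)
          (Finset.prod_nonneg fun k _ => hw0 j k)) fun j _ => ?_
        exact mul_le_mul_of_nonneg_left (hrest j) (Finset.prod_nonneg fun k _ => hw0 j k)
    _ = (4 : ℝ) ^ (N * (N - 1) / 2) * ∏ j : Fin N, ∏ k ∈ (Finset.Ioi j).filter (p j), w j k := by
        rw [Finset.prod_mul_distrib, Finset.prod_pow_eq_pow_sum, sum_card_Ioi_fin, mul_comm]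

/-! ### Laws of conjugation-invariant events (conditional on Weyl's formula) -/

/-- **Law of a conjugation-invariant event** — the "eigenvalue density" reading of Theorem 3.1 ("the unordered
eigenvalues of an `n × n` random unitary matrix have eigenvalue density `(n!(2π)ⁿ)⁻¹ ∏_{j<k}|e^{iθ_j} − e^{iθ_k}|²`"),
derived here from the class-function form `WeylIntegrationFormulaUN` applied to an indicator: for a measurable
`E ⊆ U(N)` closed under conjugation,
`Haar(E) = (N!(2π)^N)⁻¹ ∫_{[−π,π]^N} ∏_{j<k}|e^{iθ_j} − e^{iθ_k}|² · 𝟙_E(diag(e^{iθ})) dθ`.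
Conditional on the named fact (hypothesis `hW`). (Meckes 2019, Theorem 3.1, density form.) -/
theorem haar_apply_eq_of_weyl (hW : WeylIntegrationFormulaUN) (N : ℕ)
    {E : Set (Matrix.unitaryGroup (Fin N) ℂ)} (hE : MeasurableSet E)
    (hconj : ∀ U V : Matrix.unitaryGroup (Fin N) ℂ, V * U * V⁻¹ ∈ E ↔ U ∈ E) :
    haarProbability (Matrix.unitaryGroup (Fin N) ℂ) E =
      ENNReal.ofReal (((2 * π) ^ N * (N.factorial : ℝ))⁻¹) *
        ∫⁻ θ in Set.pi Set.univ (fun _ : Fin N => Set.Icc (-π) π),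
          ENNReal.ofReal (∏ j : Fin N, ∏ k ∈ Finset.Ioi j,
              ‖Complex.exp (θ j * Complex.I) - Complex.exp (θ k * Complex.I)‖ ^ 2) *
            E.indicator 1 (diagonalTorusHom (Fin N) fun j => Circle.exp (θ j)) := by
  have h := hW N (E.indicator 1) (measurable_one.indicator hE) (fun U V => by
    by_cases hU : U ∈ E
    · rw [Set.indicator_of_mem hU, Set.indicator_of_mem ((hconj U V).mpr hU), Pi.one_apply, Pi.one_apply]
    · rw [Set.indicator_of_notMem hU, Set.indicator_of_notMem (fun h => hU ((hconj U V).mp h))])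
  rw [lintegral_indicator_one hE] at h
  exact h


/-- **Flat upper bound for conjugation-invariant events** (from Weyl's formula and the crude Vandermonde
bound): `Haar(E) ≤ (N!(2π)^N)⁻¹ · 4^{N(N−1)/2} · Leb{θ ∈ [−π,π]^N : diag(e^{iθ}) ∈ E}` — the spectrum of a
Haar unitary costs at most `e^{O(N²)}` more than independent uniform eigenangles. [folklore] -/
theorem haar_apply_le_of_weyl (hW : WeylIntegrationFormulaUN) (N : ℕ)
    {E : Set (Matrix.unitaryGroup (Fin N) ℂ)} (hE : MeasurableSet E)
    (hconj : ∀ U V : Matrix.unitaryGroup (Fin N) ℂ, V * U * V⁻¹ ∈ E ↔ U ∈ E) :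
    haarProbability (Matrix.unitaryGroup (Fin N) ℂ) E ≤
      ENNReal.ofReal (((2 * π) ^ N * (N.factorial : ℝ))⁻¹ * (4 : ℝ) ^ (N * (N - 1) / 2)) *
        volume {θ : Fin N → ℝ | θ ∈ Set.pi Set.univ (fun _ : Fin N => Set.Icc (-π) π) ∧
          (diagonalTorusHom (Fin N) fun j => Circle.exp (θ j)) ∈ E} := by
  rw [haar_apply_eq_of_weyl hW N hE hconj]
  set box : Set (Fin N → ℝ) := Set.pi Set.univ (fun _ : Fin N => Set.Icc (-π) π) with hbox
  set F : Set (Fin N → ℝ) := {θ | (diagonalTorusHom (Fin N) fun j => Circle.exp (θ j)) ∈ E} with hF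
  have hFm : MeasurableSet F := (continuous_diagPhases N).measurable hE
  have hboxm : MeasurableSet box := MeasurableSet.univ_pi fun _ => measurableSet_Icc
  -- pointwise: weight · 𝟙_E(diag θ) ≤ 4^{…} · 𝟙_F(θ)
  have hpt : ∀ θ : Fin N → ℝ,
      ENNReal.ofReal (∏ j : Fin N, ∏ k ∈ Finset.Ioi j,
          ‖Complex.exp (θ j * Complex.I) - Complex.exp (θ k * Complex.I)‖ ^ 2) *
        E.indicator 1 (diagonalTorusHom (Fin N) fun j => Circle.exp (θ j)) ≤
      ENNReal.ofReal ((4 : ℝ) ^ (N * (N - 1) / 2)) * F.indicator 1 θ := by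
    intro θ
    by_cases hθ : (diagonalTorusHom (Fin N) fun j => Circle.exp (θ j)) ∈ E
    · have hθF : θ ∈ F := hθ
      rw [Set.indicator_of_mem hθ, Set.indicator_of_mem hθF, Pi.one_apply, Pi.one_apply, mul_one, mul_one]
      exact ENNReal.ofReal_le_ofReal (vandermondeCircleWeight_le N θ)
    · have hθF : θ ∉ F := hθ
      rw [Set.indicator_of_notMem hθ, Set.indicator_of_notMem hθF, mul_zero, mul_zero]
  have hint : ∫⁻ θ in box, ENNReal.ofReal (∏ j : Fin N, ∏ k ∈ Finset.Ioi j,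
          ‖Complex.exp (θ j * Complex.I) - Complex.exp (θ k * Complex.I)‖ ^ 2) *
        E.indicator 1 (diagonalTorusHom (Fin N) fun j => Circle.exp (θ j)) ≤
      ENNReal.ofReal ((4 : ℝ) ^ (N * (N - 1) / 2)) * volume {θ | θ ∈ box ∧ θ ∈ F} := by
    calc ∫⁻ θ in box, ENNReal.ofReal (∏ j : Fin N, ∏ k ∈ Finset.Ioi j,
            ‖Complex.exp (θ j * Complex.I) - Complex.exp (θ k * Complex.I)‖ ^ 2) *
          E.indicator 1 (diagonalTorusHom (Fin N) fun j => Circle.exp (θ j))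
        ≤ ∫⁻ θ in box, ENNReal.ofReal ((4 : ℝ) ^ (N * (N - 1) / 2)) * F.indicator 1 θ :=
          lintegral_mono fun θ => hpt θ
      _ = ENNReal.ofReal ((4 : ℝ) ^ (N * (N - 1) / 2)) * ∫⁻ θ in box, F.indicator 1 θ := by
          rw [lintegral_const_mul' _ _ ENNReal.ofReal_ne_top]
      _ = ENNReal.ofReal ((4 : ℝ) ^ (N * (N - 1) / 2)) * volume {θ | θ ∈ box ∧ θ ∈ F} := by
          rw [lintegral_indicator_one hFm, Measure.restrict_apply hFm, Set.inter_comm]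
          rfl
  calc ENNReal.ofReal (((2 * π) ^ N * (N.factorial : ℝ))⁻¹) *
        ∫⁻ θ in box, ENNReal.ofReal (∏ j : Fin N, ∏ k ∈ Finset.Ioi j,
            ‖Complex.exp (θ j * Complex.I) - Complex.exp (θ k * Complex.I)‖ ^ 2) *
          E.indicator 1 (diagonalTorusHom (Fin N) fun j => Circle.exp (θ j))
      ≤ ENNReal.ofReal (((2 * π) ^ N * (N.factorial : ℝ))⁻¹) *
          (ENNReal.ofReal ((4 : ℝ) ^ (N * (N - 1) / 2)) * volume {θ | θ ∈ box ∧ θ ∈ F}) :=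
        mul_le_mul' le_rfl hint
    _ = ENNReal.ofReal (((2 * π) ^ N * (N.factorial : ℝ))⁻¹ * (4 : ℝ) ^ (N * (N - 1) / 2)) *
          volume {θ | θ ∈ box ∧ θ ∈ F} := by
        rw [← mul_assoc, ← ENNReal.ofReal_mul (by positivity)]

/-! ### Spectral events are conjugation invariant -/

/-- The characteristic polynomial is a class function on `U(N)`. -/
theorem charpoly_unitary_conj {N : ℕ} (U V : Matrix.unitaryGroup (Fin N) ℂ) :
    ((V * U * V⁻¹ : Matrix.unitaryGroup (Fin N) ℂ) : Matrix (Fin N) (Fin N) ℂ).charpoly =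
      (U : Matrix (Fin N) (Fin N) ℂ).charpoly := by
  have hcoe : ((V * U * V⁻¹ : Matrix.unitaryGroup (Fin N) ℂ) : Matrix (Fin N) (Fin N) ℂ) =
      ((V : Matrix (Fin N) (Fin N) ℂ) * (U : Matrix (Fin N) (Fin N) ℂ)) * star (V : Matrix (Fin N) (Fin N) ℂ) := by
    simp
  rw [hcoe, Matrix.charpoly_mul_comm, ← mul_assoc, Matrix.UnitaryGroup.star_mul_self, one_mul]

/-- An event depending on `U` only through its characteristic polynomial is closed under conjugation. -/
theorem conjInvariant_of_charpoly {N : ℕ} (P : Polynomial ℂ → Prop) (U V : Matrix.unitaryGroup (Fin N) ℂ) :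
    V * U * V⁻¹ ∈ {W : Matrix.unitaryGroup (Fin N) ℂ | P (W : Matrix (Fin N) (Fin N) ℂ).charpoly} ↔
      U ∈ {W : Matrix.unitaryGroup (Fin N) ℂ | P (W : Matrix (Fin N) (Fin N) ℂ).charpoly} := by
  simp only [Set.mem_setOf_eq, charpoly_unitary_conj]

/-- The spectrum (root multiset of the characteristic polynomial) of `diag(e^{iθ})` is `{e^{iθ_j} : j}`. -/
theorem charpoly_roots_diagPhases (N : ℕ) (θ : Fin N → ℝ) :
    ((diagonalTorusHom (Fin N) fun j => Circle.exp (θ j) : Matrix.unitaryGroup (Fin N) ℂ) :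
        Matrix (Fin N) (Fin N) ℂ).charpoly.roots =
      (Finset.univ : Finset (Fin N)).val.map fun j => Complex.exp (θ j * Complex.I) := by
  rw [coe_diagPhases, Matrix.charpoly_diagonal]
  have h : ∏ i : Fin N, (X - C (Complex.exp (θ i * Complex.I))) =
      (((Finset.univ : Finset (Fin N)).val.map fun j => Complex.exp (θ j * Complex.I)).map
        fun a => X - C a).prod := by
    rw [Multiset.map_map]; rfl
  rw [h, Polynomial.roots_multiset_prod_X_sub_C]

/-- **Window law for spectral events** (conditional on Weyl's formula): for a property `P` of the spectrum (root
multiset of the characteristic polynomial) defining a measurable event,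
`Haar{U : P(spec U)} ≤ (N!(2π)^N)⁻¹ · 4^{N(N−1)/2} · Leb{θ ∈ [−π,π]^N : P({e^{iθ_j}})}`. -/
theorem haar_spectralEvent_le_of_weyl (hW : WeylIntegrationFormulaUN) (N : ℕ) (P : Multiset ℂ → Prop)
    (hE : MeasurableSet {W : Matrix.unitaryGroup (Fin N) ℂ | P (W : Matrix (Fin N) (Fin N) ℂ).charpoly.roots}) :
    haarProbability (Matrix.unitaryGroup (Fin N) ℂ)
        {W : Matrix.unitaryGroup (Fin N) ℂ | P (W : Matrix (Fin N) (Fin N) ℂ).charpoly.roots} ≤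
      ENNReal.ofReal (((2 * π) ^ N * (N.factorial : ℝ))⁻¹ * (4 : ℝ) ^ (N * (N - 1) / 2)) *
        volume {θ : Fin N → ℝ | θ ∈ Set.pi Set.univ (fun _ : Fin N => Set.Icc (-π) π) ∧
          P ((Finset.univ : Finset (Fin N)).val.map fun j => Complex.exp (θ j * Complex.I))} := by
  have h := haar_apply_le_of_weyl hW N hE
    (fun U V => conjInvariant_of_charpoly (fun p => P p.roots) U V)
  have hset : {θ : Fin N → ℝ | θ ∈ Set.pi Set.univ (fun _ : Fin N => Set.Icc (-π) π) ∧
      (diagonalTorusHom (Fin N) fun j => Circle.exp (θ j)) ∈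
        {W : Matrix.unitaryGroup (Fin N) ℂ | P (W : Matrix (Fin N) (Fin N) ℂ).charpoly.roots}} =
      {θ : Fin N → ℝ | θ ∈ Set.pi Set.univ (fun _ : Fin N => Set.Icc (-π) π) ∧
        P ((Finset.univ : Finset (Fin N)).val.map fun j => Complex.exp (θ j * Complex.I))} := by
    ext θ
    simp only [Set.mem_setOf_eq, charpoly_roots_diagPhases]
  rw [hset] at h
  exact h

end Summit.QuantumFields.YangMills.Theorems.EguchiKawaiDirectionLadder.SpectralWindow

end
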